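import Summits.Ventures.QEC.Census.AdditiveCertBZBridge
import HarnessLib

/-!
# `AddCert` certificates, VII: soundness of the Brouwer–Zimmermann branch on the 3n-bit image (theorems only)

Sequel of `Census/AdditiveCertBZ.lean` (data + checks) and `Census/AdditiveCertBZBridge.lean` (τ, rank tables, the replay lemma).
From the structural checks `checkBZ` and the per-matrix enumeration verdicts `bzEnum i` this file derives, for the code `c.code` of a
general-stabilizer certificate `c`: the CORE `exists_allow_of_bz` (every nonzero `w ∈ S̄⊥` of weight `≤ d − 1` is an allow-listed
word: `τ w` is a nonzero codeword of `span G_b = τ(S̄⊥)` of weight `2·swt w ≤ 2(d − 1) <` the recounted relative-rank bound, so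
qec-type-07's `bz_enumeration_span` [cite: Grassl2006, §2.1 Algorithm 2.5] — hypotheses discharged with qec-type-10's bridge lemmas
`hsys_of_systematicOK`, `rowFun_giRows_mem`, `bzBoundList_eq_bzBound` — makes it the image of an allow-listed word, and `τ` is
injective), then `IsAdditiveCode c.code c.k c.d` (`isAdditiveCode_of_bz`; with `c.allowList = []` for `k = 0` the `k = 0` clause
comes for free), the exact distance for `k > 0` (`minDistance_code_of_bz`, upper witness from `checkStructure`), purity for an empty
allow-list (`isPure_of_bz`), `additiveCodeExists_of_bz`; the assembly helpers an emitted census file uses (`checkStructureL_of_checkBZ`,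
`bzEnum_of_reaches` — one matrix verdict from ONE `Reaches` of qec-type-01's lane engine —, `bzEnum_upto_zero/succ`); and the
control: the `[[5,1,3]]` code through two information sets of its `15`-bit image (tier KERNEL; `IsAdditiveCode` only — purity and the
exact distance of `certC513` are already in the tree via `check`, chunks and lanes, and are not restated). Standard axioms; no definitions.
-/

set_option autoImplicit false

namespace Summit.Ventures.QEC.Census

open Matrix Finset Literature.InformationTheory.QuantumCodes Literature.InformationTheory.Coding

namespace AddCert

variable (c : AddCert) (z : AddBZData)

/-! ## The core: a low-weight normaliser element is allow-listed -/

/-- **Core of the BZ branch**: with all structural checks and all enumeration verdicts, every NONZERO `w ∈ S̄⊥` of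
symplectic weight `≤ d − 1` is one of the allow-listed words. Proof: `τ w` is a nonzero codeword of
`span G_b = τ(S̄⊥)` of weight `2·swt w ≤ 2(d − 1) < bzBound`, so by the Brouwer–Zimmermann enumeration theorem
(`bz_enumeration_span`, [cite: Grassl2006, §2.1 Algorithm 2.5]) it has the enumerated property "is the image of an
allow-listed word"; `τ` is injective. -/
theorem exists_allow_of_bz (hs : c.checkBZ z = true) (henum : ∀ i < z.mats.length, c.bzEnum z i = true)
    {w : SympVec c.n} (hw : w ∈ sympDual c.code) (hw0 : w ≠ 0) (hwt : sympWeight w ≤ c.d - 1) :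
    ∃ a ∈ c.allowList, ofBitPair c.n a.1 a.2 = w := by
  -- `n > 0` (else `Ē = 0`)
  rcases Nat.eq_zero_or_pos c.n with hn0 | hnpos
  · exfalso; apply hw0
    have : sympWeight w = 0 := by
      have h2 : sympWeight w ≤ Fintype.card (Fin c.n) :=
        Finset.card_le_univ (univ.filter fun i : Fin c.n => w.1 i ≠ 0 ∨ w.2 i ≠ 0)
      rw [Fintype.card_fin] at h2
      omega
    exact (sympWeight_eq_zero_iff w).1 this
  have hN : 0 < 3 * c.n := by omega
  -- unpack the checks
  have hs' := hs
  simp only [checkBZ, Bool.and_eq_true] at hs'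
  obtain ⟨⟨hsL, hg⟩, hm⟩ := hs'
  have hsL' := hsL
  rw [checkStructureL, Bool.and_eq_true] at hsL'
  obtain ⟨hst, hbnd⟩ := hsL'
  have hst' := hst
  simp only [checkStructure, Bool.and_eq_true, decide_eq_true_eq] at hst'
  obtain ⟨⟨⟨-, hind⟩, -⟩, -⟩ := hst'
  simp only [matsOK, Bool.and_eq_true, List.all_eq_true, beq_iff_eq, decide_eq_true_eq] at hm
  obtain ⟨hmats, hbound⟩ := hm
  -- per-matrix facts
  have hsysOK : ∀ i : Fin z.mats.length, matrixSysOK (3 * c.n) (c.gb3 z) z.mats[i] = true :=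
    fun i => (hmats _ (List.getElem_mem i.2)).1
  have hTlen : ∀ i : Fin z.mats.length, (z.mats[i]).T.length = (c.gb3 z).length :=
    fun i => (hmats _ (List.getElem_mem i.2)).2
  have hsys : ∀ i : Fin z.mats.length, systematicOK (3 * c.n) (giRows (c.gb3 z) z.mats[i]) (z.mats[i]).T = true :=
    fun i => by
      have := hsysOK i
      simp only [matrixSysOK, Bool.and_eq_true] at this
      exact this.1
  have hAlen : ∀ i : Fin z.mats.length, (giRows (c.gb3 z) z.mats[i]).length = (c.gb3 z).length := fun i => by
    have := hsys i
    simp only [systematicOK, Bool.and_eq_true, beq_iff_eq] at this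
    rw [this.1.1, hTlen i]
  have hTlt : ∀ (i : Fin z.mats.length) (q : ℕ), q ∈ (z.mats[i]).T → q < 3 * c.n := fun i q hq => by
    have := hsys i
    simp only [systematicOK, Bool.and_eq_true, List.all_eq_true, decide_eq_true_eq] at this
    exact this.1.2 q hq
  have henum' : ∀ i : Fin z.mats.length, matrixEnumOK c.bzW c.allow3 (c.gb3 z) z.mats[i] = true := fun i => by
    have := henum i i.2
    simp only [bzEnum, List.getElem?_eq_getElem i.2] at this
    exact this
  -- the vector as a packed pair, in the span of the generators
  obtain ⟨x, hx, zz, hzz, rfl⟩ := exists_ofBitPair_eq c.n w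
  have hspan := c.span_gens_eq_sympDual z hind hg
  have hwspan : ofBitPair c.n x zz ∈
      Submodule.span (ZMod 2) (Set.range fun i : Fin z.gens.length => ofBitPair c.n (z.gens[i]).1 (z.gens[i]).2) := by
    rw [hspan]; exact hw
  -- its image in the span of `G_b`
  have himg : tauLin c.n (ofBitPair c.n x zz) ∈
      Submodule.span (ZMod 2) (Set.range fun j : Fin (c.gb3 z).length => rowMatrix (3 * c.n) (c.gb3 z) j) := by
    have hle : Submodule.map (tauLin c.n)
        (Submodule.span (ZMod 2) (Set.range fun i : Fin z.gens.length => ofBitPair c.n (z.gens[i]).1 (z.gens[i]).2)) ≤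
        Submodule.span (ZMod 2) (Set.range fun j : Fin (c.gb3 z).length => rowMatrix (3 * c.n) (c.gb3 z) j) := by
      rw [Submodule.map_span_le]
      rintro _ ⟨i, rfl⟩
      exact c.tauLin_gen_mem_span z hg i
    exact hle ⟨_, hwspan, rfl⟩
  -- Brouwer–Zimmermann
  have hwtb : hammingNorm (tauLin c.n (ofBitPair c.n x zz)) ≤ c.bzW := by
    rw [hammingNorm_tauLin, bzW]; omega
  obtain ⟨e, he, hev⟩ := bz_enumeration_span (F := ZMod 2) (ι := Fin (3 * c.n)) (kb := (c.gb3 z).length)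
    (Gb := fun j => rowMatrix (3 * c.n) (c.gb3 z) j)
    (G := fun i : Fin z.mats.length => rowFun (3 * c.n) (giRows (c.gb3 z) z.mats[i]) (c.gb3 z).length)
    (T := fun i => colFun hN (z.mats[i]).T (c.gb3 z).length)
    (fun i j j' => hsys_of_systematicOK hN (hsys i) (hTlen i) j j')
    (fun i j => by rw [← rowSpace_rowMatrix_eq_span]; exact rowFun_giRows_mem (c.gb3 z) _ _ j)
    (t := fun i => (z.mats[i]).t) (wmax := c.bzW)
    (P := fun v => ∃ e ∈ c.allow3, ofBits (3 * c.n) e = v)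
    (fun i a ha1 hat haw => exists_allow_of_matrixEnumOK (hsysOK i) (henum' i) (hAlen i) a ha1 hat haw)
    (by rw [← bzBoundList_eq_bzBound hN hTlt hTlen]; exact hbound)
    himg (tauLin_ne_zero hw0) hwtb
  -- the allow-listed image word comes from an allow-listed Pauli word
  rw [allow3, List.mem_map] at he
  obtain ⟨a, ha, rfl⟩ := he
  refine ⟨a, ha, ?_⟩
  have hab : a.1 < 2 ^ c.n ∧ a.2 < 2 ^ c.n := by
    simp only [List.all_eq_true, Bool.and_eq_true, decide_eq_true_eq] at hbnd
    exact hbnd a ha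
  apply tauLin_injective c.n
  rw [tauLin_ofBitPair _ _ _ hab.1 hab.2, hev]

/-! ## Conclusions -/

/-- **Soundness of the BZ branch (CRSS Thm. 1 form)**: structural checks + all enumeration verdicts ⇒
`[[n, n − |rows|, d]]` (self-orthogonal, `dim S̄ + k = n`, no logical below weight `d`, and for `k = 0` no nonzero
stabilizer below weight `d`). -/
theorem isAdditiveCode_of_bz (hs : c.checkBZ z = true) (henum : ∀ i < z.mats.length, c.bzEnum z i = true) :
    IsAdditiveCode c.code c.k c.d := by
  have hs' := hs
  simp only [checkBZ, Bool.and_eq_true] at hs'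
  obtain ⟨⟨hsL, -⟩, -⟩ := hs'
  rw [checkStructureL, Bool.and_eq_true] at hsL
  have hst := hsL.1
  simp only [checkStructure, Bool.and_eq_true, decide_eq_true_eq] at hst
  obtain ⟨⟨⟨hcomm, hind⟩, hle⟩, hrest⟩ := hst
  have hso := c.isSelfOrthogonal_code hcomm
  have hdim := c.finrank_code hind
  refine ⟨hso, by rw [hdim, k]; omega, ?_, ?_⟩
  · intro w hw hw'
    by_contra hlt
    have hw0 : w ≠ 0 := fun h => hw' (h ▸ Submodule.zero_mem _)
    obtain ⟨a, ha, rfl⟩ := c.exists_allow_of_bz z hs henum hw hw0 (by omega)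
    apply hw'
    by_cases hk : c.rows.length < c.n
    · rw [if_pos hk, Bool.and_eq_true] at hrest
      rw [allowList, if_pos hk] at ha
      exact c.allow_mem_code hrest.2 a ha
    · rw [allowList, if_neg hk] at ha
      exact absurd ha List.not_mem_nil
  · intro hk0 v hv hv0
    by_contra hlt
    have hk : ¬ c.rows.length < c.n := fun hlt' => by simp [k] at hk0; omega
    obtain ⟨a, ha, -⟩ := c.exists_allow_of_bz z hs henum (hso hv) hv0 (by omega)
    rw [allowList, if_neg hk] at ha
    exact absurd ha List.not_mem_nil

/-- **Soundness, `k > 0`**: the exact minimum distance (upper witness from `checkStructure`). -/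
theorem minDistance_code_of_bz (hs : c.checkBZ z = true) (henum : ∀ i < z.mats.length, c.bzEnum z i = true)
    (hk : c.rows.length < c.n) : minDistance c.code = c.d := by
  have hcode := c.isAdditiveCode_of_bz z hs henum
  have hs' := hs
  simp only [checkBZ, Bool.and_eq_true] at hs'
  obtain ⟨⟨hsL, -⟩, -⟩ := hs'
  rw [checkStructureL, Bool.and_eq_true] at hsL
  have hst := hsL.1
  simp only [checkStructure, if_pos hk, Bool.and_eq_true, decide_eq_true_eq] at hst
  obtain ⟨⟨⟨-, -⟩, -⟩, hup, -⟩ := hst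
  simp only [upperOK, Bool.and_eq_true, beq_iff_eq] at hup
  obtain ⟨⟨⟨hsyn, hwt⟩, hnm⟩, hanti⟩ := hup
  refine minDistance_eq_of_witness ((c.mem_sympDual_code_iff c.witness).2 hsyn) ?_ ?_ hcode.2.2.1
  · intro hmem
    have hu := (c.mem_sympDual_code_iff c.nonmember).2 hnm
    have h0 : sympInner (ofBitPair c.n c.witness.1 c.witness.2)
        (ofBitPair c.n c.nonmember.1 c.nonmember.2) = 0 := (mem_sympDual_iff.1 hu) _ hmem
    rw [sympInner_comm] at h0
    exact sympInner_ne_zero_of_sympParity_eq_one c.n hanti h0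
  · rw [sympWeight_ofBitPair_eq_pw, hwt]

/-- **Purity, `k > 0` with empty allow-list**: no nonzero vector of `S̄⊥` below weight `d`. -/
theorem isPure_of_bz (hs : c.checkBZ z = true) (henum : ∀ i < z.mats.length, c.bzEnum z i = true)
    (hf : c.found = []) : IsPure c.code c.d := by
  intro w hw hw0
  by_contra hlt
  obtain ⟨a, ha, -⟩ := c.exists_allow_of_bz z hs henum hw hw0 (by omega)
  rw [allowList, hf] at ha
  split at ha <;> simp at ha

/-- The parameters are realised (BZ branch): `[[n, n − |rows|, d]]` exists. -/
theorem additiveCodeExists_of_bz (hs : c.checkBZ z = true) (henum : ∀ i < z.mats.length, c.bzEnum z i = true) :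
    AdditiveCodeExists c.n c.k c.d :=
  ⟨c.code, c.isAdditiveCode_of_bz z hs henum⟩

/-! ## Assembly helpers for emitted files -/

/-- The lane-form structural checks are part of `checkBZ` (for the `k = 0` witness via
`exists_stabilizer_weight_eq_of_structureL`). -/
theorem checkStructureL_of_checkBZ (hs : c.checkBZ z = true) : c.checkStructureL = true := by
  simp only [checkBZ, Bool.and_eq_true] at hs
  exact hs.1.1

/-- **Matrix `i` from the lane engine**: the matrix literal located in the data (`hi`), its rows `G` (`hG` by `decide`),
the threshold, allow-list and depth as literals, and ONE `Reaches` of the whole replay (e.g. by qec-type-01's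
`Plane.reaches_of_segList` from `Plane.segOK` segments) ⇒ `c.bzEnum z i = true`. -/
theorem bzEnum_of_reaches {i : ℕ} {mt : BZMatrix} (hi : z.mats[i]? = some mt) (G : List ℕ)
    (hG : giRows (c.gb3 z) mt = G) (w : ℕ) (hw : c.bzW = w) (allow : List ℕ) (hallow : c.allow3 = allow)
    {t : ℕ} (ht : mt.t = t) (h : Reaches (bzLeaf w allow) (rowPos G 0) t 0 0) : c.bzEnum z i = true := by
  rw [bzEnum, hi]
  subst hw hallow ht
  exact matrixEnumOK_of_reaches G hG h

/-- Assembly: no matrices below index `0`. -/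
theorem bzEnum_upto_zero : ∀ i < 0, c.bzEnum z i = true := fun i hi => absurd hi (Nat.not_lt_zero i)

/-- Assembly: one more matrix verdict on top. -/
theorem bzEnum_upto_succ {m : ℕ} (h : ∀ i < m, c.bzEnum z i = true) (hm : c.bzEnum z m = true) :
    ∀ i < m + 1, c.bzEnum z i = true := fun i hi => by
  rcases Nat.lt_succ_iff_lt_or_eq.1 hi with hlt | rfl
  · exact h i hlt
  · exact hm

end AddCert

/-! ## Control: `[[5,1,3]]` through two information sets of its 15-bit image (tier KERNEL) -/

/-- The structural checks of the BZ branch pass for the `[[5,1,3]]` certificate with the data `bzC513`. -/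
theorem checkBZ_certC513 : certC513.checkBZ bzC513 = true := by decide +kernel

/-- Matrix 0 of `bzC513` (the identity selection: `G_0 = G_b`): rows below `2^15`. -/
theorem g0_lt_certC513 : ∀ g ∈ ([20033, 25410, 14660, 29320, 6864, 32736] : List ℕ), g < 2 ^ 15 := by decide

/-- Matrix 0, one lane segment `[0, 6)` (all `21` selections of `≤ 2` of its `6` rows), threshold `4`. -/
theorem seg0_certC513 : Plane.segOK 15 4 [] [20033, 25410, 14660, 29320, 6864, 32736] 2 0 6 0 = true := by
  decide +kernel

/-- Matrix 0: the enumeration verdict. -/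
theorem bzEnum0_certC513 : certC513.bzEnum bzC513 0 = true :=
  certC513.bzEnum_of_reaches bzC513 (i := 0) (mt := { T := [0, 1, 2, 3, 4, 5], A := [1, 2, 4, 8, 16, 32], t := 2 })
    rfl [20033, 25410, 14660, 29320, 6864, 32736] (by decide) 4 (by decide) [] (by decide) (t := 2) rfl
    (Plane.reaches_of_segList 15 4 [] _ 2 0 g0_lt_certC513 [(0, 6)] (by decide)
      (List.forall_mem_cons.2 ⟨seg0_certC513, fun _ h => absurd h List.not_mem_nil⟩))

/-- Matrix 1 of `bzC513` (systematic on columns `6 … 11`): rows below `2^15`. -/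
theorem g1_lt_certC513 : ∀ g ∈ ([8299, 24765, 20764, 4661, 13356, 18483] : List ℕ), g < 2 ^ 15 := by decide

/-- Matrix 1, one lane segment `[0, 6)`, threshold `4`. -/
theorem seg1_certC513 : Plane.segOK 15 4 [] [8299, 24765, 20764, 4661, 13356, 18483] 2 0 6 0 = true := by
  decide +kernel

/-- Matrix 1: the enumeration verdict. -/
theorem bzEnum1_certC513 : certC513.bzEnum bzC513 1 = true :=
  certC513.bzEnum_of_reaches bzC513 (i := 1) (mt := { T := [6, 7, 8, 9, 10, 11], A := [43, 61, 28, 53, 44, 51], t := 2 })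
    rfl [8299, 24765, 20764, 4661, 13356, 18483] (by decide) 4 (by decide) [] (by decide) (t := 2) rfl
    (Plane.reaches_of_segList 15 4 [] _ 2 0 g1_lt_certC513 [(0, 6)] (by decide)
      (List.forall_mem_cons.2 ⟨seg1_certC513, fun _ h => absurd h List.not_mem_nil⟩))

/-- **Control**: `[[5,1,3]]` for `certC513.code` re-derived through the BZ branch (two matrices of depth `2` on the
15-bit image, `2 · 21` selections; tier KERNEL; the exact distance is already in the tree three times). -/
theorem isAdditiveCode_certC513_bz : IsAdditiveCode certC513.code 1 3 :=
  certC513.isAdditiveCode_of_bz bzC513 checkBZ_certC513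
    (certC513.bzEnum_upto_succ bzC513 (certC513.bzEnum_upto_succ bzC513 (certC513.bzEnum_upto_zero bzC513)
      bzEnum0_certC513) bzEnum1_certC513)

end Summit.Ventures.QEC.Census
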